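import Summits.KontsevichZagierPeriods.Zeta5Search.WedgeDictionaryLevelDescentVFull
import HarnessLib

/-!
# Level descent, zone Z: `U(b)` in closed form on over-half zones; (T3|Z) as an explicit finite identity (gen-1 g8, v3 §D)

HONEST FRAMING: systematic search; no irrationality claim unless certified.

STANDALONE VARIANT of §D of `WedgeDictionaryLevelDescentVFull.lean` v3 (sha256 see INBOX 13:3xZ), for the case that v1 (sha256 f35e5ef4…,
without §D) is the filed version: identical declarations, importing the filed file.  (Checked as part of v2: rc 0 / 0 sorry; this
standalone wrapper cannot be checked before its import lands.)

Solving P1's triangular system `pf_top_coeffs` gives `U(b)` in closed form on the whole box (`LevelDescent.coeffU_eq_sum_top`), so (T3)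
is an identity of explicit finite rational sums on every row (`ldSE_rowSource_explicit_stmt`, `rows_transfer_holds`).  On every OVER-HALF
zone `N + 1 ≤ 2b_{i+1}` all poles of `R_b` have order `≤ 5` and `U(b) = Σ_{q ≤ N} numPoly_b′(−q)/dval(q)⁶` (`coeffU_overHalf_holds`);
on the rows with `N + 1 ≤ 2b₁` this is (T3|Z) `ldSE_rowSource_zoneZ_stmt` (`zoneZ_transfer_holds`).  Internally minted; exact instances
400/400 (`N ≤ 13`).  No irrationality content.
-/

open Finset Polynomial

namespace Summit.KontsevichZagierPeriods.Zeta5Search.WedgeDictionary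

open Summit.KontsevichZagierPeriods.Zeta5Search.DualSeries
open Literature.NumberTheory.Transcendental
namespace LevelDescent

open Summit.KontsevichZagierPeriods.Zeta5Search.BigPrime (e0Z ER e0Z_ne_zero)
open Literature.NumberTheory.Transcendental.BallRivoal (pochPoly eval_pochPoly poch)

/-- **`U(b)` in closed form on the WHOLE box** (any pole orders): solving P1's triangular system `pf_top_coeffs` for the order-5
coefficient, `U(b) = Σ_{q ≤ N} (numPoly_b′(−q)·e₀(q) − numPoly_b(−q)·[X¹]E_q) / e₀(q)²`, where `e₀(q) = e0Z N q = dval(q)⁶` and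
`[X¹]E_q = (ER ℚ N q).coeff 1 = 6 e₀(q) Σ_{s ≤ N, s ≠ q} 1/(s − q)` (the harmonic-type numbers of the order-6 poles). -/
theorem coeffU_eq_sum_top (b : ℕ → ℤ) (hb : InBox b) (hsum : ∑ j ∈ range 7, b (j + 1) ≤ 3 * b 0 + 1) :
    coeffU b = ∑ q ∈ range ((b 0).toNat + 1),
      ((derivative (numPoly b)).eval (-(q : ℚ)) * ((e0Z (b 0).toNat q : ℤ) : ℚ) -
          (numPoly b).eval (-(q : ℚ)) * (ER ℚ (b 0).toNat q).coeff 1) /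
        ((e0Z (b 0).toNat q : ℤ) : ℚ) ^ 2 := by
  obtain ⟨c, hc⟩ := exists_isPFData b hb hsum
  rw [coeffU_eq hc]
  refine sum_congr rfl fun q hq => ?_
  have hq' : q ≤ (b 0).toNat := Nat.lt_succ_iff.1 (mem_range.1 hq)
  have he : ((e0Z (b 0).toNat q : ℤ) : ℚ) ≠ 0 := by exact_mod_cast e0Z_ne_zero _ q
  have h5 := (pf_top_coeffs b hc hq').1
  have h4 := (pf_top_coeffs b hc hq').2
  rw [eq_div_iff (pow_ne_zero 2 he)]
  linear_combination ((e0Z (b 0).toNat q : ℤ) : ℚ) * h4 - (ER ℚ (b 0).toNat q).coeff 1 * h5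

/-- **`U(b)` when every pole has order `≤ 5`.** If `numPoly b` vanishes at `−q` for every `q ≤ N`, then all
partial-fraction coefficients of order `6` vanish and `U(b) = Σ_{q ≤ N} numPoly_b′(−q) / dval(q)⁶` (`pf_top_coeffs`). -/
theorem coeffU_eq_sum_deriv (b : ℕ → ℤ) (hb : InBox b) (hsum : ∑ j ∈ range 7, b (j + 1) ≤ 3 * b 0 + 1)
    (hz : ∀ q, q ≤ (b 0).toNat → (numPoly b).eval (-(q : ℚ)) = 0) :
    coeffU b = ∑ q ∈ range ((b 0).toNat + 1),
      (derivative (numPoly b)).eval (-(q : ℚ)) / dval (b 0).toNat q ^ 6 := by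
  obtain ⟨c, hc⟩ := exists_isPFData b hb hsum
  rw [coeffU_eq hc]
  refine sum_congr rfl fun q hq => ?_
  have hq' : q ≤ (b 0).toNat := Nat.lt_succ_iff.1 (mem_range.1 hq)
  have he0 : ((e0Z (b 0).toNat q : ℤ) : ℚ) = dval (b 0).toNat q ^ 6 := e0Z_eq_dval_pow _ q
  have hdv : dval (b 0).toNat q ^ 6 ≠ 0 := pow_ne_zero 6 (dval_ne_zero _ q)
  have h5 := (pf_top_coeffs b hc hq').1
  rw [hz q hq', he0] at h5
  have hc5 : c 5 q = 0 := (mul_eq_zero.1 h5).resolve_right hdv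
  have h4 := (pf_top_coeffs b hc hq').2
  rw [hc5, zero_mul, add_zero, he0] at h4
  rw [eq_div_iff hdv]
  exact h4

/-- On the OVER-HALF zone of a slot (`N + 1 ≤ 2 b_{i+1}`) the numerator vanishes at every pole: the two
Pochhammer windows `[0, b_{i+1})` and `[N + 1 − b_{i+1}, N]` of that slot cover `[0, N]`. -/
theorem numPoly_eval_neg_of_overHalf (b : ℕ → ℤ) {i : ℕ} (hi : i ∈ range 7) (h0 : 0 ≤ b 0)
    (hbi : 0 ≤ b (i + 1)) (hle : b (i + 1) ≤ b 0 + 1) (hhalf : b 0 + 1 ≤ 2 * b (i + 1))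
    (q : ℕ) (hq : q ≤ (b 0).toNat) : (numPoly b).eval (-(q : ℚ)) = 0 := by
  unfold numPoly
  rw [eval_mul, eval_prod]
  apply mul_eq_zero_of_right
  apply prod_eq_zero hi
  rw [eval_mul, eval_pochPoly, eval_pochPoly]
  obtain ⟨β, hβ⟩ : ∃ β : ℕ, (b (i + 1)).toNat = β := ⟨_, rfl⟩
  obtain ⟨n, hn⟩ : ∃ n : ℕ, (b 0).toNat = n := ⟨_, rfl⟩
  have hβ' : b (i + 1) = β := by omega
  have hn' : b 0 = n := by omega
  rw [hβ]
  rw [hn] at hq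
  by_cases hlt : q < β
  · apply mul_eq_zero_of_left
    exact prod_eq_zero (mem_range.2 hlt) (by ring)
  · apply mul_eq_zero_of_right
    obtain ⟨s, hs⟩ : ∃ s : ℕ, q = n + 1 - β + s := ⟨q - (n + 1 - β), by omega⟩
    have hsβ : s < β := by omega
    have hqz : (q : ℤ) = n + 1 - β + s := by omega
    have hqq : (q : ℚ) = n + 1 - β + s := by exact_mod_cast hqz
    refine prod_eq_zero (mem_range.2 hsβ) ?_
    rw [hn', hβ', hqq]
    push_cast
    ring

/-- **`U(b)` on an over-half zone.** For `b` in the box with `Σ_j b_j ≤ 3N + 1` and `N + 1 ≤ 2 b_{i+1}` for some slot `i < 7`: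
`U(b) = Σ_{q ≤ N} numPoly_b′(−q) / dval(q)⁶` — a closed finite sum (the nonzero terms are the poles of order exactly `5`). -/
theorem coeffU_overHalf (b : ℕ → ℤ) (hb : InBox b) (hsum : ∑ j ∈ range 7, b (j + 1) ≤ 3 * b 0 + 1)
    {i : ℕ} (hi : i ∈ range 7) (hhalf : b 0 + 1 ≤ 2 * b (i + 1)) :
    coeffU b = ∑ q ∈ range ((b 0).toNat + 1),
      (derivative (numPoly b)).eval (-(q : ℚ)) / dval (b 0).toNat q ^ 6 :=
  coeffU_eq_sum_deriv b hb hsum fun q hq =>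
    numPoly_eval_neg_of_overHalf b hi hb.1 (hb.2 i hi).1 (hb.2 i hi).2 hhalf q hq

end LevelDescent

/-- STATEMENT (PROVED: `coeffU_overHalf_holds`): `U(b)` in closed form on every over-half zone `N + 1 ≤ 2b_{i+1}`. -/
def coeffU_overHalf_stmt : Prop :=
  ∀ b : ℕ → ℤ, InBox b → (∑ j ∈ range 7, b (j + 1) ≤ 3 * b 0 + 1) → ∀ i ∈ range 7, b 0 + 1 ≤ 2 * b (i + 1) →
    coeffU b = ∑ q ∈ range ((b 0).toNat + 1),
      (derivative (numPoly b)).eval (-(q : ℚ)) / LevelDescent.dval (b 0).toNat q ^ 6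

/-- **PROVED:** `U(b) = Σ_{q ≤ N} numPoly_b′(−q)/dval(q)⁶` on every over-half zone. -/
theorem coeffU_overHalf_holds : coeffU_overHalf_stmt := fun b hb hsum _ hi hh =>
  LevelDescent.coeffU_overHalf b hb hsum hi hh

/-- **(T3|Z)** — the row-source identity on zone Z (`N + 1 ≤ 2b₁`) with `U(b)` replaced by its closed form: an identity
between two explicit finite sums of rationals (left: `ldSE = Σ_μ Ω̄_μ · ldKer_μ`; right: `Σ_q numPoly_b′(−q)/dval(q)⁶`).
Internally minted (gen-1 g8); exact instances 400/400 (`N ≤ 13`); equivalent to (T3) on zone Z (`zoneZ_transfer_holds`). -/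
@[conjecture] def ldSE_rowSource_zoneZ_stmt : Prop :=
  ∀ b : ℕ → ℤ, 0 ≤ b 0 → (∀ j ∈ Icc 1 7, 0 ≤ b j ∧ b j ≤ b 0) → (∀ j ∈ Icc 3 6, 2 * b j ≤ b 0) → 0 ≤ dOf b →
    1 ≤ b 2 → b 7 = 0 → b 1 + b 2 ≤ b 0 → b 0 + 1 ≤ 2 * b 1 →
    ((dOf b : ℚ) + 1) * ldSE b - mixedPi2 b * ldSE (lowerSlot b 2) =
      rowEta (lowerSlot b 2) * ∑ q ∈ range ((b 0).toNat + 1),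
        (derivative (numPoly b)).eval (-(q : ℚ)) / LevelDescent.dval (b 0).toNat q ^ 6

/-- `U(b)` in closed form under the hypotheses of (T3) on zone Z. -/
theorem coeffU_zoneZ (b : ℕ → ℤ) (h0 : 0 ≤ b 0) (hS : ∀ j ∈ Icc 1 7, 0 ≤ b j ∧ b j ≤ b 0) (hd : 0 ≤ dOf b)
    (hz : b 0 + 1 ≤ 2 * b 1) :
    coeffU b = ∑ q ∈ range ((b 0).toNat + 1),
      (derivative (numPoly b)).eval (-(q : ℚ)) / LevelDescent.dval (b 0).toNat q ^ 6 := by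
  have hb : InBox b := by
    refine ⟨h0, fun j hj => ?_⟩
    have := hS (j + 1) (by simp only [mem_Icc]; have := mem_range.1 hj; omega)
    exact ⟨this.1, by omega⟩
  have hsum : ∑ j ∈ range 7, b (j + 1) ≤ 3 * b 0 + 1 := by unfold dOf at hd; omega
  exact LevelDescent.coeffU_overHalf b hb hsum (i := 0) (by simp) (by simpa using hz)

/-- STATEMENT (PROVED: `zoneZ_transfer_holds`): (T3|Z) **is** (T3) restricted to zone Z. -/
def zoneZ_transfer_stmt : Prop :=
  ldSE_rowSource_zoneZ_stmt ↔
    ∀ b : ℕ → ℤ, 0 ≤ b 0 → (∀ j ∈ Icc 1 7, 0 ≤ b j ∧ b j ≤ b 0) → (∀ j ∈ Icc 3 6, 2 * b j ≤ b 0) → 0 ≤ dOf b →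
      1 ≤ b 2 → b 7 = 0 → b 1 + b 2 ≤ b 0 → b 0 + 1 ≤ 2 * b 1 →
      ((dOf b : ℚ) + 1) * ldSE b - mixedPi2 b * ldSE (lowerSlot b 2) = rowEta (lowerSlot b 2) * coeffU b

/-- **PROVED:** (T3|Z) ↔ (T3) on zone Z (`coeffU_zoneZ`). In particular `ldSE_rowSource_stmt` implies (T3|Z). -/
theorem zoneZ_transfer_holds : zoneZ_transfer_stmt := by
  constructor
  · intro hZ b h0 hS hB hd h2 h7 h12 hz
    rw [coeffU_zoneZ b h0 hS hd hz]
    exact hZ b h0 hS hB hd h2 h7 h12 hz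
  · intro hT b h0 hS hB hd h2 h7 h12 hz
    rw [← coeffU_zoneZ b h0 hS hd hz]
    exact hT b h0 hS hB hd h2 h7 h12 hz

/-- **(T3) EXPLICIT on all rows**: the row-source identity with `U(b)` replaced by its closed form `LevelDescent.coeffU_eq_sum_top` — an identity
between two explicit finite sums of rationals on EVERY row `b₇ = 0` (the `U` side carries the harmonic-type numbers `[X¹]E_q/e₀(q)` of the order-6
poles; on zone Z they drop out: `ldSE_rowSource_zoneZ_stmt`). -/
@[conjecture] def ldSE_rowSource_explicit_stmt : Prop :=
  ∀ b : ℕ → ℤ, 0 ≤ b 0 → (∀ j ∈ Icc 1 7, 0 ≤ b j ∧ b j ≤ b 0) → (∀ j ∈ Icc 3 6, 2 * b j ≤ b 0) → 0 ≤ dOf b →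
    1 ≤ b 2 → b 7 = 0 → b 1 + b 2 ≤ b 0 →
    ((dOf b : ℚ) + 1) * ldSE b - mixedPi2 b * ldSE (lowerSlot b 2) =
      rowEta (lowerSlot b 2) * ∑ q ∈ range ((b 0).toNat + 1),
        ((derivative (numPoly b)).eval (-(q : ℚ)) * ((BigPrime.e0Z (b 0).toNat q : ℤ) : ℚ) -
            (numPoly b).eval (-(q : ℚ)) * (BigPrime.ER ℚ (b 0).toNat q).coeff 1) /
          ((BigPrime.e0Z (b 0).toNat q : ℤ) : ℚ) ^ 2

/-- `U(b)` in closed form under the hypotheses of (T3). -/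
theorem coeffU_rows (b : ℕ → ℤ) (h0 : 0 ≤ b 0) (hS : ∀ j ∈ Icc 1 7, 0 ≤ b j ∧ b j ≤ b 0) (hd : 0 ≤ dOf b) :
    coeffU b = ∑ q ∈ range ((b 0).toNat + 1),
      ((derivative (numPoly b)).eval (-(q : ℚ)) * ((BigPrime.e0Z (b 0).toNat q : ℤ) : ℚ) -
          (numPoly b).eval (-(q : ℚ)) * (BigPrime.ER ℚ (b 0).toNat q).coeff 1) /
        ((BigPrime.e0Z (b 0).toNat q : ℤ) : ℚ) ^ 2 := by
  have hb : InBox b := by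
    refine ⟨h0, fun j hj => ?_⟩
    have := hS (j + 1) (by simp only [mem_Icc]; have := mem_range.1 hj; omega)
    exact ⟨this.1, by omega⟩
  have hsum : ∑ j ∈ range 7, b (j + 1) ≤ 3 * b 0 + 1 := by unfold dOf at hd; omega
  exact LevelDescent.coeffU_eq_sum_top b hb hsum

/-- STATEMENT (PROVED: `rows_transfer_holds`): the explicit form **is** (T3). -/
def rows_transfer_stmt : Prop := ldSE_rowSource_explicit_stmt ↔ ldSE_rowSource_stmt

/-- **PROVED:** `ldSE_rowSource_explicit_stmt ↔ ldSE_rowSource_stmt` (`coeffU_rows`): the one remaining hypothesis of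
`levelDescentVFull_reduction` is an identity between explicit finite rational sums. -/
theorem rows_transfer_holds : rows_transfer_stmt := by
  constructor
  · intro hE b h0 hS hB hd h2 h7 h12
    rw [coeffU_rows b h0 hS hd]
    exact hE b h0 hS hB hd h2 h7 h12
  · intro hT b h0 hS hB hd h2 h7 h12
    rw [← coeffU_rows b h0 hS hd]
    exact hT b h0 hS hB hd h2 h7 h12

end Summit.KontsevichZagierPeriods.Zeta5Search.WedgeDictionary
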